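import Summits.BirchSwinnertonDyer.BirchSwinnertonDyer.Theorems.SylvesterTwoHeegnerIndexCoupledTelescopeStep
import Literature.GroupTheory.FiniteAbelian.CharacterModuleUnitAddCircle
import HarnessLib

/-!
# The COUPLED Cassels–Tate telescope, III′: the two COUNTS behind the tail's currency conversion
# (coisotropic subgroups of a finite group with a `ℚ/ℤ`-valued pairing; `𝒪`-spans of torsion lifts)

Companion of `…Theorems.SylvesterTwoHeegnerIndexCoupledTelescopeStep` / `…CoupledTelescope` (the
engine `∑ N_i ≤ M₀`), written for the census theorems `tailFour/SevenOf…` (crux `UpperOffV0HSYPlus`,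
stmt-BirchSwinnertonDyer-19804, VARIANT M stubs `stub_tailFour` / `stub_tailSeven`; planner D558
(K1-c), D564 (c)): the TAIL reads `s_B + s_A ≤ ord₂(qB·qA)`, the engine gives `∑ N_i ≤ M₀`, and the
conversion `s_B + s_A ≤ 2·∑ N_i` must be PROVED from STRUCTURAL leaves — (coiso) «the images of the
lifts span a subgroup `D_X ≤ Ш(X_K)[2^∞]` containing its own orthogonal for a bi-additive
`ℚ/ℤ`-valued pairing» (McCallum p. 288: `D` maximal isotropic, `#Ш = (#D)²`) and (gen) «`D_X` is
covered by the `𝒪`-span of the lifts» — by finite-group algebra.  This file supplies that algebra,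
abstractly:

* `natCard_le_sq_of_coisotropic` — for a FINITE additive group `G`, a bi-additive
  `B : G → G → ℚ/ℤ` and `D ≤ G` with `D^⊥ ≤ D`: **`#G ≤ (#D)²`** (the map `t ↦ B(t, ·)|_D` has kernel
  `D^⊥ ≤ D` and lands in `Hom(D, ℚ/ℤ) ≃ D`, Pontryagin duality for finite abelian groups = the tree's
  `FiniteAbelian.nonempty_addMonoidHom_ratAddCircle_addEquiv`).  No non-degeneracy and no alternation
  is needed for the inequality.
* `emod_zsmul` — `(a % n) • v = a • v` when `n • v = 0`.
* `finite_and_natCard_closure_le` — for a family `s_i` (`i ∈ I`) with `n_i • s_i = 0`, `0 < n_i`, and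
  an additive operator `w`, the `𝒪`-span `closure (S ∪ w '' S)`, `S = {s_i}`, is FINITE of order
  **`≤ (∏ n_i)²`** (surjection from `∏ (ℤ/n_i)²`, via `exists_sum_of_mem_closure` of part I).
* `padicValNat_two_le_of_le_pow` — `n ≠ 0`, `n ≤ 2^k ⟹ ord₂ n ≤ k` (so no `p`-group lemma is needed
  to read `s_X = ord₂ #Ш(X/ℚ)[2^∞]` off a cardinality bound).

Theorem-only (no definition, no named fact); pure algebra; nothing asserted on 19804; BSD not claimed.
Sources: McCallum 1991 (LMS LN 153) §5 (p. 288, proof of Thm. 5.4: «choose a maximal isotropic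
subgroup `D`»); MEMO-bsd-cm-two §59.1 (iii), §64.0/§64.5 SET-UP.
-/

-- every Summits module is named `Summit.<Summit>.<Problem>…`: the duplicated component is by design
set_option linter.dupNamespace false
set_option autoImplicit false

noncomputable section

open scoped Classical

namespace Summit.BirchSwinnertonDyer.BirchSwinnertonDyer.Theorems.SylvesterTwoCoupledTelescope

/-! ## §A. Coisotropic subgroups: `#G ≤ (#D)²` -/

section Coisotropic

variable {G : Type*} [AddCommGroup G]

/-- **`#G ≤ (#D)²` for a coisotropic subgroup** (`D^⊥ ≤ D`) of a finite additive group with a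
bi-additive `ℚ/ℤ`-valued pairing — the counting half of «a maximal isotropic subgroup of a symplectic
module has order `√#G`» (McCallum 1991, p. 288), in the inequality form the TAIL needs and WITHOUT
non-degeneracy: `t ↦ B(t,·)|_D : G → Hom(D, ℚ/ℤ)` has kernel `D^⊥ ≤ D`, and `#Hom(D, ℚ/ℤ) = #D`
(Pontryagin). [cite: McCallumLMS1991, §5 (p. 288)] -/
theorem natCard_le_sq_of_coisotropic [Finite G] (B : G →+ G →+ AddCircle (1 : ℚ))
    (D : AddSubgroup G) (hco : ∀ t, (∀ d ∈ D, B t d = 0) → t ∈ D) :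
    Nat.card G ≤ Nat.card D ^ 2 := by
  -- restriction of characters to `D`
  let φ : G →+ (D →+ AddCircle (1 : ℚ)) :=
    { toFun := fun t ↦ (B t).comp D.subtype
      map_zero' := by ext d; simp
      map_add' := fun a b ↦ by ext d; simp }
  have hker : φ.ker ≤ D := fun t ht ↦ hco t fun d hd ↦ by
    have h := DFunLike.congr_fun (AddMonoidHom.mem_ker.mp ht) ⟨d, hd⟩
    simpa [φ] using h
  obtain ⟨e⟩ := Literature.GroupTheory.FiniteAbelian.nonempty_addMonoidHom_ratAddCircle_addEquiv
    (A := D)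
  haveI : Finite (D →+ AddCircle (1 : ℚ)) := Finite.of_equiv _ e.toEquiv.symm
  have h1 : Nat.card G = Nat.card φ.range * Nat.card φ.ker := by
    rw [← Nat.card_congr (QuotientAddGroup.quotientKerEquivRange φ).toEquiv,
      AddSubgroup.card_eq_card_quotient_mul_card_addSubgroup φ.ker]
  have h2 : Nat.card φ.ker ≤ Nat.card D := AddSubgroup.card_le_of_le hker
  have h3 : Nat.card φ.range ≤ Nat.card D := by
    rw [← Nat.card_congr e.toEquiv]
    exact AddSubgroup.card_le_card_addGroup _
  calc Nat.card G = Nat.card φ.range * Nat.card φ.ker := h1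
    _ ≤ Nat.card D * Nat.card D := Nat.mul_le_mul h3 h2
    _ = Nat.card D ^ 2 := (sq _).symm

end Coisotropic

/-! ## §B. The order of the `𝒪`-span of torsion lifts -/

section Span

variable {V : Type*} [AddCommGroup V]

/-- Reducing an integer scalar modulo the order: `(a % n) • v = a • v` if `n • v = 0`. [folklore] -/
theorem emod_zsmul {n : ℕ} {v : V} (h : (n : ℤ) • v = 0) (a : ℤ) : (a % n) • v = a • v := by
  rw [Int.emod_def, sub_smul, mul_comm, mul_smul, h, smul_zero, sub_zero]

/-- **The `𝒪`-span of finitely many torsion lifts is finite, of order at most `(∏ n_i)²`**: for a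
family `s_i` (`i ∈ I`) with `n_i • s_i = 0`, `0 < n_i`, and an additive operator `w`, every element of
`closure (S ∪ w '' S)` (`S = {s_i : i ∈ I}`) is `∑ (α_i s_i + β_i w s_i)` with `α_i, β_i ∈ ℤ/n_i`
(part I `exists_sum_of_mem_closure`), so `∏ (ℤ/n_i)²` surjects onto it.  With `n_i = 2^{N_i}`:
`#(𝒪·⟨s_i⟩) ≤ 4^{∑ N_i}` (memo two §64.0: `𝒪 d_i ≅ 𝒪₂/2^{N_i}` has order `4^{N_i}`). [folklore] -/
theorem finite_and_natCard_closure_le (w : V →+ V) (s : ℕ → V) (n : ℕ → ℕ) (I : Finset ℕ)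
    (hn : ∀ i ∈ I, 0 < n i) (hs : ∀ i ∈ I, ((n i : ℕ) : ℤ) • s i = 0) :
    Finite (AddSubgroup.closure (((I.image s : Finset V) : Set V) ∪ w '' ((I.image s : Finset V) : Set V)))
      ∧ Nat.card (AddSubgroup.closure
          (((I.image s : Finset V) : Set V) ∪ w '' ((I.image s : Finset V) : Set V))) ≤
        (∏ i ∈ I, n i) ^ 2 := by
  set S := AddSubgroup.closure
    (((I.image s : Finset V) : Set V) ∪ w '' ((I.image s : Finset V) : Set V)) with hS
  haveI hne : ∀ i : I, NeZero (n i) := fun i ↦ ⟨(hn i i.2).ne'⟩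
  -- the generators and their `w`-images lie in `S`
  have hsS : ∀ i ∈ I, s i ∈ S := fun i hi ↦
    AddSubgroup.subset_closure (Set.mem_union_left _ (by
      rw [Finset.coe_image]; exact Set.mem_image_of_mem _ (Finset.mem_coe.mpr hi)))
  have hwS : ∀ i ∈ I, w (s i) ∈ S := fun i hi ↦
    AddSubgroup.subset_closure (Set.mem_union_right _ (by
      rw [Finset.coe_image]; exact ⟨s i, Set.mem_image_of_mem _ (Finset.mem_coe.mpr hi), rfl⟩))
  -- the surjection from `∏ (ℤ/n_i)²`
  let F : ((i : I) → ZMod (n i) × ZMod (n i)) → S := fun c ↦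
    ⟨∑ i : I, ((((c i).1.val : ℕ) : ℤ) • s i + (((c i).2.val : ℕ) : ℤ) • w (s i)),
      AddSubgroup.sum_mem _ fun i _ ↦ add_mem (AddSubgroup.zsmul_mem _ (hsS i i.2) _)
        (AddSubgroup.zsmul_mem _ (hwS i i.2) _)⟩
  have hF : Function.Surjective F := by
    rintro ⟨v, hv⟩
    obtain ⟨α, β, rfl⟩ := exists_sum_of_mem_closure w s I hv
    refine ⟨fun i ↦ (((α i : ℤ) : ZMod (n i)), ((β i : ℤ) : ZMod (n i))), Subtype.ext ?_⟩
    simp only [F]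
    rw [← Finset.sum_coe_sort I (fun i ↦ α i • s i + β i • w (s i))]
    refine Finset.sum_congr rfl fun i _ ↦ ?_
    have hws : ((n i : ℕ) : ℤ) • w (s i) = 0 := by rw [← map_zsmul, hs i i.2, map_zero]
    rw [ZMod.val_intCast, ZMod.val_intCast, emod_zsmul (hs i i.2), emod_zsmul hws]
  haveI : Finite S := Finite.of_surjective F hF
  refine ⟨inferInstance, ?_⟩
  calc Nat.card S ≤ Nat.card ((i : I) → ZMod (n i) × ZMod (n i)) :=
        Nat.card_le_card_of_surjective F hF
    _ = ∏ i : I, (n i * n i) := by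
        rw [Nat.card_pi]
        exact Finset.prod_congr rfl fun i _ ↦ by rw [Nat.card_prod, Nat.card_zmod]
    _ = (∏ i ∈ I, n i) ^ 2 := by
        rw [sq, ← Finset.prod_mul_distrib, Finset.prod_coe_sort I (fun i ↦ n i * n i)]

end Span

/-! ## §C. Reading a `2`-adic valuation off a cardinality bound -/

/-- `n ≠ 0` and `n ≤ 2^k` give `ord₂ n ≤ k` (`2^{ord₂ n} ∣ n`). [folklore] -/
theorem padicValNat_two_le_of_le_pow {n k : ℕ} (hn : n ≠ 0) (h : n ≤ 2 ^ k) :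
    padicValNat 2 n ≤ k := by
  have hd : 2 ^ padicValNat 2 n ∣ n := pow_padicValNat_dvd
  have hle := (Nat.le_of_dvd (Nat.pos_of_ne_zero hn) hd).trans h
  exact (Nat.pow_le_pow_iff_right (by norm_num)).mp hle

end Summit.BirchSwinnertonDyer.BirchSwinnertonDyer.Theorems.SylvesterTwoCoupledTelescope

end
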